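import Literature.NumberTheory.EllipticCurves.PAdicLFunctionTame
import HarnessLib

/-!
# The ONE-TERM (`ε(p) = 0`) Mazur–Tate–Teitelbaum plus measure at a TAME LEVEL `m` and its `χ`-twisted
# cyclotomic transform `L_p(f, α, χ, T)` — the objects of Matsuno 2000 §2 at a prime `p ∣ N` of
# MULTIPLICATIVE reduction (DEFINITIONS ONLY: every `def` has a body; nothing asserted, no named fact)

Companion of `Literature.NumberTheory.EllipticCurves.PAdicLFunctionTame` (the TWO-term measure
`msdMeasureTame f m α n a b = α⁻ⁿ[c/(pⁿm)]⁺ − α⁻⁽ⁿ⁺¹⁾[c/(pⁿ⁻¹m)]⁺`, Mazur–Tate–Teitelbaum §I.10 (10.1) with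
Nebentypus value `ε(p) = 1`, i.e. a prime `p ∤ N` of GOOD reduction; its `TODO(general form)` line asks for
`ε(p)`). At a prime `p ∣ N` (for the newform of an elliptic curve: `p ‖ N`, MULTIPLICATIVE reduction) the
printed measure has `ε(p) = 0` (§I.10: "`ε(p) = 0` if `p ∣ N`"), the allowable root is `α = a_p ∈ {1, −1}`
(the `U_p`-eigenvalue), and display (10.1) reads with ONE term:
`μ_{f,α}(a + pⁿM ℤ_{p,M}) = α⁻ⁿ Φ(a/(pⁿM))`. This file TYPES that measure at a tame modulus `m` prime to `p`
and its `χ`-twisted transform, in EXACTLY the normalisation of `PAdicLFunctionTame` (Chinese-remainder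
representative `tameRep`, tame fraction `tameFraction`, Riemann sums over ALL of `ℤ_pˣ` including the torsion,
variable `1 + T ↔ γ = cyclotomicGenerator p`, `χ` mod `m` with values in `ℚ_p`):

* `msdMeasureTameMult f m α n a b = μ_{f,α,m}((a + pⁿℤ_p) × {b}) = α⁻ⁿ · [c/(pⁿm)]⁺_f`, `c = tameRep p m n a b`
  (K. Matsuno, J. Number Theory 84 (2000), §2 p. 83, the measure `μ_{E,m}` for `E` "good ordinary … or
  multiplicative … at `p`", p. 82, in the multiplicative case; MTT §I.10 (10.1) with `ε(p) = 0`);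
* `padicLRiemannSumTameMult`, `padicLCoeffTameMult`, **`padicLFunctionTameMult f m α χ`** — the Riemann sums
  `∑_η ∑_{s mod pⁿ} ∑_{b mod m} χ(b) μ_{f,α,m}((ηγˢ + p^{n+e₀}ℤ_p) × {b}) · (s choose k)`, their limits, and
  `L_p(f, α, χ, T) = ∫_{ℤ_pˣ × ℤ/m} χ(x_m)(1+T)^{ℓ(x_p)} dμ_{f,α,m}` (MTT §I.13 with a tame character; Matsuno's
  `G_{p,m}(E, χ, T)`), the SAME shapes as `padicLRiemannSumTame` / `padicLCoeffTame` / `padicLFunctionTame`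
  with the one-term measure in place of the two-term one;
* `padicLRiemannSumTameMult_eq_sum_weighted` — re-bracketing: the Riemann sums are those of the `χ`-WEIGHTED
  `ℚ_p`-valued distribution `ν_χ(a + pⁿℤ_p) = ∑_b χ(b) μ_{f,α,m}((a + pⁿℤ_p) × {b})` on `ℤ_p`, the shape consumed
  by the tree's abstract Mellin–Mazur transform (`PAdicMeasureTransform`: `tendsto_riemannSum_of_distribution`,
  `hasSum_limUnder_riemannSum_mul_pow_of_distribution`; `tendsto_riemannSum_translate`);
* anchors at `m = 1`: `msdMeasureTameMult_one` (`= α⁻ⁿ[a/pⁿ]⁺`), and `padicLRiemannSumTameMult_one_eq` — at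
  `m = 1`, `χ = 1` the Riemann sums are LITERALLY those of the tree's split (`α = 1`,
  `IsSplitMultPAdicLFunctionOf.tendsto_riemannSum_coeff`) and non-split (`α = −1`,
  `IsMultPAdicLFunctionOf.tendsto_riemannSum_coeff_of_nonsplit`) package theorems, so THE `p`-adic
  `L`-function of the interpolation package `IsMultPAdicLFunctionOf f p α L` is `padicLFunctionTameMult f 1 α 1`
  (proved in the companion `PAdicLFunctionTameMultProofs`, not here).

PROPERTIES (distribution relation in the `p`-direction from the `U_p`-relation
`a_p[x]⁺ = ∑_{u mod p}[(x+u)/p]⁺`, tree theorem `intCast_mul_ratPlusSymbol_of_dvd`; boundedness; convergence; change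
of tame level = Matsuno's Lemma 2.2 with `ε(ℓ) = 1` at the GOOD primes `ℓ ∣ m`; Lemma 3.3; the Birch transform;
integrality at `p = 2`) are ALL proved in companion `…Proofs` files; NOTHING is asserted here and there is NO named
fact. CONSUMER: cell bsd-2adic (run/shared/lean/pub/bsd-2adic/), seat conv-1 GEN 13 — the analytic Kida formula at
a MULTIPLICATIVE `2` (the displayed clause `TwoAdicMultTwist.MultTwistLambdaAnAtTwo` of the S3 route's twist-family
doors), Matsuno 2000 Thm. 3.1 read at `p = 2` for `L = ℚ(√d)` totally real.

References: B. Mazur, J. Tate, J. Teitelbaum, Invent. Math. 84 (1986), §I.10 (10.1)–(10.2) ("`ε(p) = 0` if `p ∣ N`"),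
§I.13, §I.14 [MazurTateTeitelbaum1986Invent]; K. Matsuno, J. Number Theory 84 (2000), §2 (pp. 82–85)
[Matsuno2000]; R. Greenberg, LNM 1716 (1999), §4 (PDF p. 113: one factor `(1 − α_p⁻¹)` at a multiplicative prime)
[GreenbergLNM1716].
-/

noncomputable section

open scoped MatrixGroups ModularForm

open CongruenceSubgroup Filter Topology Literature.NumberTheory.EllipticCurves.ModularForms

namespace Literature.NumberTheory.EllipticCurves

/-! ### The one-term measure at tame level `m` -/

section Measure

variable {N : ℕ} (f : CuspForm (Gamma0 N) 2) {p : ℕ} [Fact p.Prime] (m : ℕ)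

/-- The **one-term Mazur–Tate–Teitelbaum plus measure at tame level `m`** (Nebentypus value `ε(p) = 0`, the
case `p ∣ N`): `μ_{f,α,m}((a + pⁿℤ_p) × {b}) = α⁻ⁿ · [c/(pⁿm)]⁺_f` for `a : ZMod (p ^ n)`, `b : ZMod m`,
`c = tameRep p m n a b` the Chinese-remainder representative (MTT §I.10 (10.1) with `ε(p) = 0`,
`Φ ↦ [·]⁺_f = ratPlusSymbol f`, cast `ℚ → ℚ_p`; Matsuno 2000 §2, `μ_{E,m}` for `E` multiplicative at `p`). It is a
distribution when `α = a_p(f)` is the `U_p`-eigenvalue (`p ∣ N`; proved in the companion file); for the newform of an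
elliptic curve multiplicative at `p`, `α = a_p ∈ {1, −1}`. Junk (harmless) for `(m, p) ≠ 1`.
[cite: MazurTateTeitelbaum1986Invent, §I.10 (10.1) (pp. 12–13)] [cite: Matsuno2000, §2 (pp. 82–83, the measure μ_{E,m})] -/
def msdMeasureTameMult (α : ℚ_[p]) (n : ℕ) (a : ZMod (p ^ n)) (b : ZMod m) : ℚ_[p] :=
  α⁻¹ ^ n * (ratPlusSymbol f (tameFraction p m n a b) : ℚ_[p])

/-- **Anchor**: at tame level `m = 1` the one-term tame measure is `α⁻ⁿ · [a/pⁿ]⁺_f` (`tameFraction_one`) — the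
distribution `μ(a + pⁿℤ_p) = α⁻ⁿ[a/pⁿ]⁺_f` of the tree's split (`α = 1`) / non-split (`α = −1`) package theorems.
[cite: MazurTateTeitelbaum1986Invent, §I.10 (10.1) (pp. 12–13)] -/
theorem msdMeasureTameMult_one (α : ℚ_[p]) (n : ℕ) (a : ZMod (p ^ n)) (b : ZMod 1) :
    msdMeasureTameMult f 1 α n a b = α⁻¹ ^ n * (ratPlusSymbol f ((a.val : ℚ) / (p : ℚ) ^ n) : ℚ_[p]) := by
  rw [msdMeasureTameMult, tameFraction_one]

end Measure

/-! ### The `χ`-twisted transform at tame level `m` -/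

section LFunction

variable {N : ℕ} (f : CuspForm (Gamma0 N) 2) {p : ℕ} [Fact p.Prime] (m : ℕ) [NeZero m]

/-- The `n`-th **Riemann sum** for the `k`-th coefficient of the one-term `L_p(f, α, χ, T)` at tame level `m`:
`∑_η ∑_{s mod pⁿ} ∑_{b mod m} χ(b) · μ_{f,α,m}((η γˢ + p^{n+e₀}ℤ_p) × {b}) · (s choose k)` — the shape of
`padicLRiemannSumTame` with the one-term measure. [cite: MazurTateTeitelbaum1986Invent, §I.13 (pp. 18–19)] -/
def padicLRiemannSumTameMult (α : ℚ_[p]) (χ : DirichletCharacter ℚ_[p] m) (k n : ℕ) : ℚ_[p] :=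
  ∑ᶠ η : rootsOfUnity (torsionOrder p) ℤ_[p], ∑ s : ZMod (p ^ n), ∑ b : ZMod m,
    χ b *
      msdMeasureTameMult f m α (n + cyclotomicExponent p)
          (PadicInt.toZModPow (n + cyclotomicExponent p) ((η : ℤ_[p]ˣ) : ℤ_[p]) *
            (cyclotomicGenerator p : ZMod (p ^ (n + cyclotomicExponent p))) ^ s.val) b *
      (s.val.choose k : ℚ_[p])

/-- The `k`-th **coefficient** of the one-term `L_p(f, α, χ, T)` at tame level `m`: the limit of the Riemann sums
(junk value of `limUnder` off the convergent case). [cite: MazurTateTeitelbaum1986Invent, §I.11–I.13 (pp. 13–19)] -/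
def padicLCoeffTameMult (α : ℚ_[p]) (χ : DirichletCharacter ℚ_[p] m) (k : ℕ) : ℚ_[p] :=
  limUnder atTop (padicLRiemannSumTameMult f m α χ k)

/-- The **one-term `χ`-twisted `p`-adic `L`-function at tame level `m`** (`ε(p) = 0`, i.e. `p ∣ N`):
`L_p(f, α, χ, T) = ∫_{ℤ_pˣ × ℤ/m} χ(x_m) (1 + T)^{ℓ(x_p)} dμ_{f,α,m} ∈ ℚ_p⟦T⟧` — Matsuno's `G_{p,m}(E, χ, T)`
(§2 p. 84) for `E` multiplicative at `p`, in the tree's normalisation of `padicLFunctionTame`. For `m = 1`, `χ = 1`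
and `α = a_p ∈ {±1}` it is THE function of the interpolation package `IsMultPAdicLFunctionOf f p α ·` (companion
file); for `χ = 𝟙_m` the `m`-depleted function; for `χ = χ_d` the function whose Birch transform is the package
function of the quadratic twist. [cite: MazurTateTeitelbaum1986Invent, §I.13 (pp. 18–19)]
[cite: Matsuno2000, §2 (p. 84, G_{p,m}(E, χ, T))] -/
def padicLFunctionTameMult (α : ℚ_[p]) (χ : DirichletCharacter ℚ_[p] m) : PowerSeries ℚ_[p] :=
  PowerSeries.mk (padicLCoeffTameMult f m α χ)

/-- The `k`-th coefficient of `padicLFunctionTameMult f m α χ` is `padicLCoeffTameMult f m α χ k` (unfolding).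
[cite: MazurTateTeitelbaum1986Invent, §I.13 (pp. 18–19)] -/
theorem coeff_padicLFunctionTameMult (α : ℚ_[p]) (χ : DirichletCharacter ℚ_[p] m) (k : ℕ) :
    PowerSeries.coeff k (padicLFunctionTameMult f m α χ) = padicLCoeffTameMult f m α χ k :=
  PowerSeries.coeff_mk _ _

/-- **Re-bracketing**: the Riemann sum is the Riemann sum (in the sense of `PAdicMeasureTransform`) of the
`χ`-WEIGHTED distribution `a ↦ ∑_{b mod m} χ(b) μ_{f,α,m}((a + pⁿℤ_p) × {b})` on `ℤ_p`.
[cite: MazurTateTeitelbaum1986Invent, §I.13 (pp. 18–19)] -/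
theorem padicLRiemannSumTameMult_eq_sum_weighted (α : ℚ_[p]) (χ : DirichletCharacter ℚ_[p] m) (k n : ℕ) :
    padicLRiemannSumTameMult f m α χ k n =
      ∑ᶠ ζ : rootsOfUnity (torsionOrder p) ℤ_[p], ∑ s : ZMod (p ^ n),
        (fun (n : ℕ) (a : ZMod (p ^ n)) ↦ ∑ b : ZMod m, χ b * msdMeasureTameMult f m α n a b)
          (n + cyclotomicExponent p)
          (PadicInt.toZModPow (n + cyclotomicExponent p) ((ζ : ℤ_[p]ˣ) : ℤ_[p]) *
            (cyclotomicGenerator p : ZMod (p ^ (n + cyclotomicExponent p))) ^ s.val) *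
          (s.val.choose k : ℚ_[p]) := by
  unfold padicLRiemannSumTameMult
  refine finsum_congr fun ζ ↦ Finset.sum_congr rfl fun s _ ↦ ?_
  rw [Finset.sum_mul]

end LFunction

/-! #### Anchor at `m = 1`, `χ = 1`: the Riemann sums of the split / non-split package theorems -/

section Anchor

variable {N : ℕ} (f : CuspForm (Gamma0 N) 2) {p : ℕ} [Fact p.Prime]

/-- **Anchor**: at `m = 1`, `χ = 1` the one-term tame Riemann sum is
`∑_η ∑_s α⁻⁽ⁿ⁺ᵉ⁾ [η γˢ/p^{n+e}]⁺_f · (s choose k)` (`χ(0) = 1` in `ℤ/1`; `msdMeasureTameMult_one`) — for `α = 1`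
literally the Riemann sum of `IsSplitMultPAdicLFunctionOf.tendsto_riemannSum_coeff`, for `α = −1` that of
`IsMultPAdicLFunctionOf.tendsto_riemannSum_coeff_of_nonsplit`. [cite: MazurTateTeitelbaum1986Invent, §I.13 (pp. 18–19)] -/
theorem padicLRiemannSumTameMult_one_eq (α : ℚ_[p]) (k n : ℕ) :
    padicLRiemannSumTameMult f 1 α (1 : DirichletCharacter ℚ_[p] 1) k n =
      ∑ᶠ η : rootsOfUnity (torsionOrder p) ℤ_[p], ∑ s : ZMod (p ^ n),
        (α⁻¹ ^ (n + cyclotomicExponent p) *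
          (ratPlusSymbol f
            (((PadicInt.toZModPow (n + cyclotomicExponent p) ((η : ℤ_[p]ˣ) : ℤ_[p]) *
                (cyclotomicGenerator p : ZMod (p ^ (n + cyclotomicExponent p))) ^ s.val).val : ℚ) /
              (p : ℚ) ^ (n + cyclotomicExponent p)) : ℚ_[p])) *
          (s.val.choose k : ℚ_[p]) := by
  unfold padicLRiemannSumTameMult
  refine finsum_congr fun η => Finset.sum_congr rfl fun s _ => ?_
  rw [Fintype.sum_subsingleton _ (1 : ZMod 1), map_one, one_mul, msdMeasureTameMult_one]

end Anchor

end Literature.NumberTheory.EllipticCurves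

end
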